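import Summits.BirchSwinnertonDyer.BirchSwinnertonDyer.Theorems.ClassRecordThreeCornerAtThreeShimuraSwapFamilyTilde
import Summits.BirchSwinnertonDyer.BirchSwinnertonDyer.Theorems.Rank1ResidualJetSwapStepKolyvagin
import Summits.BirchSwinnertonDyer.BirchSwinnertonDyer.Theorems.ClassRecordThreeShimuraKolyvaginFixedOfTorsion
import HarnessLib

/-!
# PORT-SPEC (P1), file 2: Kolyvagin's PRIME SWAP for a GENERALISED Kolyvagin datum, brick 2a — the `λ'` half
# (root class, auxiliary class, Čebotarev) — family twin of bsd-jet pv-2's `Swap.exists_swapPrime` and of this seat's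
# `Swap.exists_swapPrime_of_irreducible` (cell `bsd-stepL`, seat `bsd-stepL-corner-p1` g15; `--supports stmt-BirchSwinnertonDyer-21420 --as helper`)

WHY. The typed port target `ShimuraWalk.SwapSupplyAt[ThreeB6]` (corner3-p2 g7 p592703 ∕ tam3-p1 g13 `…ShimuraWalkB6Defs`) and
tam3-p1 g12's family combinator `KolyvaginFamilyData.pDiv_of_swap_of_perLevel` (p592810) both consume McCallum 1991 Prop. 5.2
(`C = {0}`, «level raising at minimal depth») for the labelled CM family of `X_{N⁺,N⁻}`, whose level-`n` data are
`JET.KolyvaginFamilyData W K ι n` (RULING 46 (P0′)) — never `KolyvaginHeegnerData`. The kernel swap (bsd-jet bricks 2a ∕ 2b ∕ 4)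
touches the datum only as a carrier; what it takes from `X₀(N)` are (i) admissibility `E(K[n])[p^∞] = 0` and the invariance
of `[P_n]` mod `p^{1+u}` (Gross 4.3 ∕ 3.6), (ii) the `τ`-sign of `c_{1+u}(n)` (Gross 5.3–5.4), (iii) `E(K)[p] = 0`, (iv) the
Čebotarev prime (McCallum Cor. 3.2 ∕ Jetchev Lemma 5.1; image hypothesis), and — in brick 2b — McCallum 4.4 and the Selmer
membership of the root classes. THIS FILE is brick 2a with (i)–(iv) as DISPLAYED HYPOTHESES on ONE family datum `d` of conductor
`n` (standing inputs `hA` ∕ `hP`, sign `hκsign` with an abstract sign `e₀ = ±1`, torsion leaf `hbot`, Čebotarev `hceb` landing in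
W. Zhang's Kolyvagin primes of index `≥ 1 + u` AND in an abstract target predicate `Fine` — so that one brick serves the numeric
index and Gross's depth (3.2) alike); the Poitou–Tate package, Weil datum, transverse family and local index stay hypotheses
exactly as in bsd-jet's brick. PROOF: bsd-jet's, byte for byte, with the root class from file 1
(`KolyvaginFamilyData.exists_rootClass_of_exactDepth`, `…torsionH1OfDvd_rootClass_eq`) and the injectivity of `ι_*` from
shim-p1's `torsionH1OfDvd_pow_injective_of_torsionBy_eq_bot`. HONEST FRAMING: one theorem, no definition ∕ fact ∕ sorry; CONDITIONAL
on the displayed inputs; nothing about any curve; no stub ∕ item closes; BSD is not proved by any of this; T7. Credit: bsd-jet pv-2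
(statement, proof), tam3-p1 (supplies, family datum), shim-p1 (torsion leaf).
References (locators only): [cite: McCallumLMS1991, §5 Prop. 5.2 and proof (pp. 304–306), Lemma 5.3, §3 Cor. 3.2]
[cite: Jetchev2008, §3.1 item 7, Lemma 5.1, Lemma 5.2 (iii)] [cite: GrossLMS1991, Prop. 5.4, Prop. 9.6] [cite: BurungaleEtAl2026, Prop. 2.2.1].
presearch: not applicable (re-keying of tree theorems). Design: no definitions; `K : Type`. Axioms: `propext`, `Classical.choice`, `Quot.sound`.
-/

set_option autoImplicit false

noncomputable section

open scoped Classical Pointwise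
open Function NumberField IsDedekindDomain WeierstrassCurve Field
open Literature.NumberTheory.EllipticCurves Literature.NumberTheory.GaloisRepresentations
open Literature.NumberTheory.EllipticCurves.Jetchev2008 Literature.NumberTheory.EllipticCurves.KolyvaginCocycle
open Literature.NumberTheory.EllipticCurves.ModularForms
open Literature.NumberTheory.GaloisCohomology Literature.NumberTheory.Automorphic
open Literature.NumberTheory.GaloisRepresentations.DiscreteGaloisModule (transverseSubgroup SelmerStructure)
open Summit.BirchSwinnertonDyer.Rank1Residual.JET.SelmerVocabulary
open Summit.BirchSwinnertonDyer.Rank1Residual.JET.GlobalDuality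
open Summit.BirchSwinnertonDyer.Rank1Residual.X11b
open Summit.BirchSwinnertonDyer.Rank1Residual.X11b.Three
open Summit.BirchSwinnertonDyer.BirchSwinnertonDyer.Theorems
open Summit.BirchSwinnertonDyer.BirchSwinnertonDyer.Theorems.ShimuraKolyvaginFixedOfTorsion

namespace Summit.BirchSwinnertonDyer.Rank1Residual.JET.Swap

variable {K : Type} [Field K] [NumberField K] (W : WeierstrassCurve ℚ) [W.IsElliptic]
  [W.IsGloballyMinimal]

section Prime

variable (τ : K ≃ₐ[ℚ] K) (p : ℕ) [Fact p.Prime] [NeZero (p ^ 1)]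
  [Finite (geomTorsion (W.baseChange K) ((p ^ 1 : ℕ) : ℤ))]
  (e : geomTorsion (W.baseChange K) ((p ^ 1 : ℕ) : ℤ) → geomTorsion (W.baseChange K) ((p ^ 1 : ℕ) : ℤ) →
    AlgebraicClosure K)
  (hμ : ∀ S T, e S T ^ (p ^ 1) = 1)
  (hadd₁ : ∀ S₁ S₂ T, e (S₁ + S₂) T = e S₁ T * e S₂ T)
  (hadd₂ : ∀ S T₁ T₂, e S (T₁ + T₂) = e S T₁ * e S T₂)
  (hgal : ∀ (g : absoluteGaloisGroup K) (S T : geomTorsion (W.baseChange K) ((p ^ 1 : ℕ) : ℤ)),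
    g • e S T = e (g • S) (g • T))
  (halt : ∀ T, e T T = 1) (hnondeg : ∀ T, (∀ S, e S T = 1) → T = 0)
  (hτe : ∀ S T, liftAut τ (e S T) =
    e ((isLiftOfAut_liftAut τ).torsionMap W ((p ^ 1 : ℕ) : ℤ) S)
      ((isLiftOfAut_liftAut τ).torsionMap W ((p ^ 1 : ℕ) : ℤ) T))

include halt hnondeg hτe in
/-- **The `λ'` half of Kolyvagin's swap for a GENERALISED Kolyvagin datum** (McCallum, proof of Prop. 5.2, pp. 305–306,
with Lemma 5.3 and Cor. 3.2; run at level `p` on the root class). Data: `K` imaginary quadratic with the non-trivial `τ`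
(`τ² = 1`), `p` odd, the level-`p` Poitou–Tate package and Weil datum, a transverse family `𝒯` at level `p` (`τ`-stable,
self-dual at the places over W. Zhang's Kolyvagin primes) with the local index `hloc`; a family datum `d` of square-free
conductor `n` over Kolyvagin primes of index `≥ 1 + u`, with its STANDING INPUTS at level `p^{1+u}` (`hA`, `hP`), its sign
`τ_* c_{1+u}(n) = e₀ • c_{1+u}(n)` (`e₀ = ±1`), EXACT depth `u` (`hdvd`, `hndvd`); `E(K)[p] = 0` (`hbot`); a Čebotarev supply
`hceb` for pairs of opposite eigenclasses landing in Kolyvagin primes of index `≥ 1 + u` satisfying `Fine`; a prime `ℓ₀ ∣ n` and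
a bound `b`. CONCLUSION: a Kolyvagin prime `ℓ' > b` of index `≥ 1 + u` with `Fine ℓ'`, `ℓ' ∤ n`, places `λ' ∋ ℓ'`, `λ₀ ∋ ℓ₀`,
a class `t ∈ (H¹_{𝓕(n/ℓ₀)^{λ₀}})^{−e₀}` with `loc_{λ'} t ≠ 0`, and `loc_{λ'} c_{1+u}(n) ≠ 0`.
[cite: McCallumLMS1991, §5 proof of Prop. 5.2 (pp. 305–306), Lemma 5.3] [cite: Jetchev2008, Lemma 5.1, Lemma 5.2 (iii)] -/
theorem exists_swapPrime_family (hK : IsImaginaryQuadratic K) (hp2 : p ≠ 2) (hττ : τ * τ = 1)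
    {ι : K →+* ℂ}
    (inv : LocalInvariants K (p ^ 1)) (hperf : inv.IsPerfect) (hvan : inv.SumLocalTermEqZero)
    (hSC : inv.SelmerComplement) (hinv : inv.IsConjCompatible τ)
    (𝒯 : SelmerStructure ((W.baseChange K).torsionGaloisModule ((p ^ 1 : ℕ) : ℤ)))
    (h𝒯σ : ∀ (c : ℕ), Squarefree c →
      (∀ q ∈ c.primeFactors, Zhang2014.IsKolyvaginPrime (W.conductorNorm ℤ) W K p q) →
      ∀ (v w : HeightOneSpectrum (𝓞 K)) (h : τ • v = w), v ∈ placesDividing K c →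
      ∀ x : galoisCohomology (((W.baseChange K).torsionGaloisModule ((p ^ 1 : ℕ) : ℤ)).toLocal
        (Sum.inr v : Place K)) 1,
      x ∈ 𝒯 (Sum.inr v) → conjActPlace W τ ((p ^ 1 : ℕ) : ℤ) h x ∈ 𝒯 (Sum.inr w))
    (h𝒯sd : ∀ (c : ℕ), Squarefree c →
      (∀ q ∈ c.primeFactors, Zhang2014.IsKolyvaginPrime (W.conductorNorm ℤ) W K p q) →
      ∀ v ∈ placesDividing K c,
      inv.dualTransported 𝒯 (weilDualIntertwining (W.baseChange K) (p ^ 1) e hμ hadd₁ hadd₂ hgal)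
        (Sum.inr v) = 𝒯 (Sum.inr v))
    (hloc : ∀ ℓ : ℕ, Zhang2014.IsKolyvaginPrime (W.conductorNorm ℤ) W K p ℓ →
      1 ≤ Zhang2014.kolyvaginIndex W p ℓ →
      ∀ (v : HeightOneSpectrum (𝓞 K)), (ℓ : 𝓞 K) ∈ v.asIdeal → ∀ (hfix : τ • v = v) (s : ℤ),
      (s = 1 ∨ s = -1) →
      ((W.baseChange K).kummerSelmerStructure ((p ^ 1 : ℕ) : ℤ) (Sum.inr v)).relIndex
        ((conjActPlace W τ ((p ^ 1 : ℕ) : ℤ) hfix - s • AddMonoidHom.id _).ker) = p ^ 1)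
    -- `E(K)[p] = 0` (injectivity of the change of level `ι_*`)
    (hbot : AddSubgroup.torsionBy (W.baseChange K).toAffine.Point (p : ℤ) = ⊥)
    -- the Čebotarev supply: deep Kolyvagin primes in the target `Fine`, keeping a pair of opposite eigenclasses alive
    {u : ℕ} (Fine : ℕ → Prop)
    (hceb : ∀ (e₁ : ℤ), (e₁ = 1 ∨ e₁ = -1) →
      ∀ (x y : galoisCohomology ((W.baseChange K).torsionGaloisModule ((p ^ 1 : ℕ) : ℤ)) 1),
      conjAct W τ ((p ^ 1 : ℕ) : ℤ) x = e₁ • x → conjAct W τ ((p ^ 1 : ℕ) : ℤ) y = (-e₁) • y → y ≠ 0 →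
      ∀ (b : ℕ), ∃ ℓ : ℕ, b < ℓ ∧ Zhang2014.IsKolyvaginPrime (W.conductorNorm ℤ) W K p ℓ ∧
        1 + u ≤ Zhang2014.kolyvaginIndex W p ℓ ∧ Fine ℓ ∧
        ∀ v : HeightOneSpectrum (𝓞 K), (ℓ : 𝓞 K) ∈ v.asIdeal →
          addOrderOf (galoisCohomology.localization
              ((W.baseChange K).torsionGaloisModule ((p ^ 1 : ℕ) : ℤ)) (Sum.inr v) 1 x) = addOrderOf x ∧
          addOrderOf (galoisCohomology.localization
              ((W.baseChange K).torsionGaloisModule ((p ^ 1 : ℕ) : ℤ)) (Sum.inr v) 1 y) = addOrderOf y)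
    -- the datum and its inputs
    (b : ℕ) {n l₀ : ℕ} (hn : Squarefree n)
    (hnK : ∀ q ∈ n.primeFactors, Zhang2014.IsKolyvaginPrime (W.conductorNorm ℤ) W K p q ∧
      1 + u ≤ Zhang2014.kolyvaginIndex W p q)
    (hl₀ : l₀ ∈ n.primeFactors)
    (d : KolyvaginFamilyData W K ι n)
    (hA : IsAdmissible (absoluteGaloisGroup K) d.pointsSubgroup ((p ^ (1 + u) : ℕ) : ℤ))
    (hP : d.toGeomPoints d.derivedPoint ∈ invPoints (absoluteGaloisGroup K) d.pointsSubgroup ((p ^ (1 + u) : ℕ) : ℤ))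
    {e₀ : ℤ} (he₀ : e₀ = 1 ∨ e₀ = -1)
    (hκsign : conjAct W τ ((p ^ (1 + u) : ℕ) : ℤ) (d.kolyvaginClass (Fact.out : p.Prime) (1 + u)) =
      e₀ • d.kolyvaginClass (Fact.out : p.Prime) (1 + u))
    (hdvd : ∃ Q : (W.baseChange (ringClassField K ι n)).toAffine.Point,
      ((p ^ u : ℕ) : ℤ) • Q = d.derivedPoint)
    (hndvd : ¬ ∃ Q : (W.baseChange (ringClassField K ι n)).toAffine.Point,
      ((p ^ (u + 1) : ℕ) : ℤ) • Q = d.derivedPoint) :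
    ∃ (ℓ' : ℕ) (v' v₀ : HeightOneSpectrum (𝓞 K))
      (t : galoisCohomology ((W.baseChange K).torsionGaloisModule ((p ^ 1 : ℕ) : ℤ)) 1),
      b < ℓ' ∧ Zhang2014.IsKolyvaginPrime (W.conductorNorm ℤ) W K p ℓ' ∧
      1 + u ≤ Zhang2014.kolyvaginIndex W p ℓ' ∧ Fine ℓ' ∧ ℓ' ∉ n.primeFactors ∧
      (ℓ' : 𝓞 K) ∈ v'.asIdeal ∧ (l₀ : 𝓞 K) ∈ v₀.asIdeal ∧
      t ∈ signPart W K τ ((p ^ 1 : ℕ) : ℤ) (-e₀)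
        (((selmerF W ((p ^ 1 : ℕ) : ℤ) 𝒯 (placesDividing K (n / l₀))).relaxedAt {v₀}).selmerGroup) ∧
      galoisCohomology.localization ((W.baseChange K).torsionGaloisModule ((p ^ 1 : ℕ) : ℤ))
        (Sum.inr v' : Place K) 1 t ≠ 0 ∧
      galoisCohomology.localization ((W.baseChange K).torsionGaloisModule ((p ^ (1 + u) : ℕ) : ℤ))
        (Sum.inr v' : Place K) 1 (d.kolyvaginClass (Fact.out : p.Prime) (1 + u)) ≠ 0 := by
  have hp : p.Prime := Fact.out
  have hn0 : n ≠ 0 := hn.ne_zero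
  have hl₀p : l₀.Prime := Nat.prime_of_mem_primeFactors hl₀
  have hl₀n : l₀ ∣ n := Nat.dvd_of_mem_primeFactors hl₀
  have hKol₀ : Zhang2014.IsKolyvaginPrime (W.conductorNorm ℤ) W K p l₀ := (hnK l₀ hl₀).1
  -- §1 the root class `x = c₁(P_n / p^u)`: order `p`, sign `e₀`
  obtain ⟨hA1, Q, hQ, hQP, hord, -⟩ :=
    d.exists_rootClass_of_exactDepth hp (k := 1) (u := u) le_rfl hA hP hdvd hndvd
  set x : galH1Torsion (W.baseChange K) ((p ^ 1 : ℕ) : ℤ) :=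
    kolyvaginClass (W.baseChange K) ((p ^ 1 : ℕ) : ℤ)
      ((W.baseChange K).zsmul_geomPoints_surjective_of_charZero
        (by exact_mod_cast pow_ne_zero 1 hp.ne_zero)) hA1 (d.toGeomPoints Q) hQ with hxdef
  have hx0 : x ≠ 0 := by
    intro h
    have : addOrderOf x = 1 := by rw [h, addOrderOf_zero]
    rw [hord, pow_one] at this
    exact hp.one_lt.ne' this
  -- the sign of `x`: transported DOWN from the sign of `c_{1+u}(P_n)` along the injective `ι_*`
  have hroot := d.torsionH1OfDvd_rootClass_eq hp 1 u hA Q hA1 hQ hQP hP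
  have hdn : p ^ 1 ∣ p ^ (1 + u) := pow_dvd_pow p (Nat.le_add_right 1 u)
  have hxsign : conjAct W τ ((p ^ 1 : ℕ) : ℤ) x = e₀ • x :=
    conjAct_eq_smul_of_torsionH1OfDvd W τ _ (torsionH1OfDvd_pow_injective_of_torsionBy_eq_bot W hbot 1 u) e₀ x
      (by rw [hroot]; exact hκsign)
  -- §2 the place `λ₀ ∋ ℓ₀`; the conductor `m = n / ℓ₀`
  obtain ⟨v₀, hv₀⟩ := exists_place_natCast_mem (K := K) hl₀p hKol₀.2.2.2.2.1
  set m : ℕ := n / l₀ with hmdef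
  have hmn : m ∣ n := Nat.div_dvd_of_dvd hl₀n
  have hm : Squarefree m := hn.squarefree_of_dvd hmn
  have hm0 : m ≠ 0 := hm.ne_zero
  have hmK : ∀ q ∈ m.primeFactors, Zhang2014.IsKolyvaginPrime (W.conductorNorm ℤ) W K p q :=
    fun q hq ↦ (hnK q (Nat.primeFactors_mono hmn hn0 hq)).1
  have hl₀m : l₀ ∉ m.primeFactors := by
    intro h
    have hdvd' : l₀ * l₀ ∣ n := by
      have := Nat.mul_dvd_mul_left l₀ (Nat.dvd_of_mem_primeFactors h)
      rwa [Nat.mul_div_cancel' hl₀n] at this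
    exact hl₀p.one_lt.ne' (Nat.isUnit_iff.mp (hn l₀ hdvd'))
  -- §3 the auxiliary class `t` (Jetchev Lemma 5.2 (iii) at the relaxed place `λ₀ ∤ m`)
  have hs : (-e₀ = 1 ∨ -e₀ = -1) := by rcases he₀ with h | h <;> [right; left] <;> omega
  have hcount := Walk.natCard_map_localization_signPart_relaxedAt W τ p 1 e hμ hadd₁ hadd₂ hgal halt
    hnondeg hτe hττ hp2 le_rfl inv hperf hvan hSC hinv 𝒯 hm0 (h𝒯σ m hm hmK) (h𝒯sd m hm hmK) hs
    (fun ℓ hℓ hk _ v hv hfix ↦ hloc ℓ hℓ hk v hv hfix _ hs) l₀ hKol₀ hKol₀.2.2.2.2.2 hl₀m v₀ hv₀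
  obtain ⟨t, ht, ht₀⟩ := exists_mem_map_ne_zero _ _ (by rw [hcount, pow_one]; exact hp.one_lt.ne')
  have ht0 : t ≠ 0 := fun h ↦ ht₀ (by rw [h, map_zero])
  have htsign : conjAct W τ ((p ^ 1 : ℕ) : ℤ) t = (-e₀) • t := ((mem_signPart_iff W K τ _ _ _ t).mp ht).2
  -- §4 the decoupled Čebotarev prime `ℓ'`
  obtain ⟨ℓ', hbℓ', hKol', h1u, hFine, hordloc⟩ := hceb e₀ he₀ x t hxsign htsign ht0 (max b n)
  have hℓ'p : ℓ'.Prime := hKol'.1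
  have hbℓ : b < ℓ' := lt_of_le_of_lt (le_max_left b n) hbℓ'
  have hℓ'n : ℓ' ∉ n.primeFactors := fun h ↦ by
    have := Nat.le_of_dvd (Nat.pos_of_ne_zero hn0) (Nat.dvd_of_mem_primeFactors h)
    exact absurd (lt_of_le_of_lt (le_max_right b n) hbℓ') (not_lt.mpr this)
  obtain ⟨v', hv'⟩ := exists_place_natCast_mem (K := K) hℓ'p hKol'.2.2.2.2.1
  obtain ⟨hxloc, htloc⟩ := hordloc v' hv'
  have htv' : galoisCohomology.localization ((W.baseChange K).torsionGaloisModule ((p ^ 1 : ℕ) : ℤ))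
      (Sum.inr v' : Place K) 1 t ≠ 0 := by
    intro h
    rw [h, addOrderOf_zero] at htloc
    exact ht0 (AddMonoid.addOrderOf_eq_one_iff.mp htloc.symm)
  have hxv' : galoisCohomology.localization ((W.baseChange K).torsionGaloisModule ((p ^ 1 : ℕ) : ℤ))
      (Sum.inr v' : Place K) 1 x ≠ 0 := by
    intro h
    rw [h, addOrderOf_zero] at hxloc
    exact hx0 (AddMonoid.addOrderOf_eq_one_iff.mp hxloc.symm)
  -- §5 transport one level up at `λ'`: `ι_* x = c_{1+u}(P_n)`, `Γ_{K_λ'}` fixes `E[p^{1+u}]`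
  have htriv : ∀ (g : absoluteGaloisGroup (v'.adicCompletion K))
      (P : geomTorsion (W.baseChange K) ((p ^ (1 + u) : ℕ) : ℤ)), resGal (K := K) (v'.adicCompletion K) g • P = P :=
    Walk.resGal_adicCompletion_smul_torsion_eq_self W hK hKol' h1u v' hv'
  have hxup : galoisCohomology.localization ((W.baseChange K).torsionGaloisModule ((p ^ (1 + u) : ℕ) : ℤ))
      (Sum.inr v' : Place K) 1 (d.kolyvaginClass hp (1 + u)) ≠ 0 := by
    rw [← hroot]
    exact fun h ↦ hxv' ((localization_eq_zero_iff_torsionH1OfDvd W hdn (pow_ne_zero 1 hp.ne_zero)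
      (pow_ne_zero _ hp.ne_zero) v' htriv x).mpr h)
  exact ⟨ℓ', v', v₀, t, hbℓ, hKol', h1u, hFine, hℓ'n, hv', hv₀, ht, htv', hxup⟩

end Prime

/-- **Sign bookkeeping of the walk** (appended, g15): for `ε = ±1` and any `n`, `ε·(−1)^{#primes of n} = ±1` — the shape of `e₀` fed to
`exists_swapPrime_family` by the walk (file 4). [cite: GrossLMS1991, §5 Prop. 5.4 (the sign ε_n = ε·(−1)^{f_n})] -/
theorem sign_mul_neg_one_pow_card_eq_one_or {εf : ℤ} (hεf : εf = 1 ∨ εf = -1) (n : ℕ) :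
    εf * (-1) ^ n.primeFactors.card = 1 ∨ εf * (-1) ^ n.primeFactors.card = -1 := by
  rcases hεf with h1 | h1 <;> rcases neg_one_pow_eq_or ℤ n.primeFactors.card with h | h <;> simp [h1, h]

end Summit.BirchSwinnertonDyer.Rank1Residual.JET.Swap

end
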